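import Literature.AlgebraicGeometry.Resolution.BlowupSNC
import Literature.AlgebraicGeometry.Resolution.EffectiveCartierStalks
import Literature.AlgebraicGeometry.Resolution.AlterationsSectionDivisor
import HarnessLib

/-!
# [OURS · L1 W4.5(b) · EL♮(3)] TOWER₃ stand-in S7 `hBaseKC`, clause (viii): THE EXCEPTIONAL DIVISOR CUTS AN EFFECTIVE CARTIER DIVISOR ON EVERY
# STRICT TRANSFORM — `IsEffectiveCartier ((C·𝒪_{X′}).comap (St_π K).subschemeι)`

Crux chain w45b (cell `res-hironaka`, slot W4.5(b)), working crux **EL♮** = stmt-ResolutionOfSingularities-20038, child **EL♮(3)** =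
stmt-ResolutionOfSingularities-20148, route EquisingularLift, line `sections`; rung TOWER₃ (res-D-pv-029's assembly `hsub_reachTower_three`, stand-in
S7 `hBaseKC` := res-type-100 per CHAIN v7.31 §1 (1)): clause (viii) of `TCPlus.MemberKC` (res-D-pv-029 …NatSubchainSupplierInvKDefs p554345)
`IsEffectiveCartier (𝓢.comap K.subschemeι)` for the pair `(𝓢, K) = (E, St_{τ₁} K₀)` of the base members. HONEST FRAMING: OURS; NOT a statement
of any manuscript; AI-written, weaker than expert review. No `sorry`; standard axioms. DEF-FREE. `--supports stmt-ResolutionOfSingularities-20148 --as helper`.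

WHAT. For ANY morphism `π : X′ → X` with `X′` locally Noetherian, any ideal sheaves `C, K` on `X` such that the exceptional ideal
`E = C·𝒪_{X′}` is an effective Cartier divisor (e.g. `π` the blowing up along `C`): the restriction of `E` to the strict transform
`V(St_π K)`, `St_π K = ⋃ₙ (K·𝒪_{X′} : Eⁿ)`, is an effective Cartier divisor — because the strict transform is `E`-SATURATED: at every point,
`t·a ∈ (St K)_z ⇒ a ∈ (St K)_z` for the local equation `t` of `E` (tree `stalkIdeal_strictTransformIdeal`), so the image of `t` in
`𝒪_{V(St K),z} = 𝒪_{X′,z} ⧸ (St K)_z` is a non-zero-divisor (Stacks 01WS via tree `isEffectiveCartier_of_forall_mem_nonZeroDivisors`).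
* `mem_stalkIdeal_strictTransformIdeal_of_mul_mem` — the saturation.
* **`isEffectiveCartier_comap_subschemeι_strictTransformIdeal`** — clause (viii).

References: tree `Literature/AlgebraicGeometry/Resolution/BlowupSNC.lean` (`stalkIdeal_strictTransformIdeal`), `EffectiveCartierStalks.lean`
(Stacks 01WS), `AlterationsSectionDivisor.lean` (`stalkIdeal_ker_eq_ker_stalkMap`). [cite: StacksProject, Tag 01WS; StacksProject, Tag 080E]
-/

set_option linter.dupNamespace false -- mandated namespace `Summit.<Summit>.<Problem>` of this single-conjunct summit

noncomputable section

open CategoryTheory AlgebraicGeometry TopologicalSpace IsLocalRing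
open Literature.AlgebraicGeometry.Resolution
open AlgebraicGeometry.Scheme.IdealSheafData

namespace Summit.ResolutionOfSingularities.ResolutionOfSingularities.Cruxes.EquisingularLiftNat.Sections

universe u

variable {X X' : Scheme.{u}} [IsLocallyNoetherian X'] (π : X' ⟶ X) (C K : X.IdealSheafData)

/-- **The strict transform is saturated by the exceptional divisor**: if `E_z = (t)` and `t·a ∈ (St_π K)_z` then `a ∈ (St_π K)_z`.
[cite: StacksProject, Tag 080E] -/
theorem mem_stalkIdeal_strictTransformIdeal_of_mul_mem (z : X') {t : X'.presheaf.stalk z}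
    (ht : stalkIdeal (C.comap π) z = Ideal.span {t}) {a : X'.presheaf.stalk z}
    (h : t * a ∈ stalkIdeal (strictTransformIdeal π C K) z) : a ∈ stalkIdeal (strictTransformIdeal π C K) z := by
  rw [stalkIdeal_strictTransformIdeal, ht] at h ⊢
  have hdir : Directed (· ≤ ·) fun n : ℕ => Submodule.colon ((stalkIdeal K (π z)).map (π.stalkMap z).hom)
      ((Ideal.span {t} ^ n : Ideal _) : Set (X'.presheaf.stalk z)) := by
    refine Monotone.directed_le fun m n hmn => Submodule.colon_mono le_rfl ?_
    exact Ideal.pow_le_pow_right hmn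
  obtain ⟨n, hn⟩ := (Submodule.mem_iSup_of_directed _ hdir).mp h
  refine (Submodule.mem_iSup_of_directed _ hdir).mpr ⟨n + 1, ?_⟩
  rw [Submodule.mem_colon] at hn ⊢
  intro p hp
  rw [Ideal.span_singleton_pow, SetLike.mem_coe, Ideal.mem_span_singleton'] at hp
  obtain ⟨r, rfl⟩ := hp
  have h1 : (t * a) • (r * t ^ n) ∈ (stalkIdeal K (π z)).map (π.stalkMap z).hom := by
    apply hn
    rw [Ideal.span_singleton_pow, SetLike.mem_coe]
    exact Ideal.mem_span_singleton'.mpr ⟨r, rfl⟩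
  have h2 : a • (r * t ^ (n + 1)) = (t * a) • (r * t ^ n) := by
    simp only [smul_eq_mul]; ring
  rw [h2]
  exact h1

/-- **(viii) The exceptional divisor cuts an effective Cartier divisor on every strict transform** (see the module docstring).
[cite: StacksProject, Tag 01WS; StacksProject, Tag 080E] [OURS · L1 W4.5b] TOWER₃ S7 clause (viii); NOT a statement of the manuscript. -/
theorem isEffectiveCartier_comap_subschemeι_strictTransformIdeal (hE : IsEffectiveCartier (C.comap π)) :
    IsEffectiveCartier ((C.comap π).comap (strictTransformIdeal π C K).subschemeι) := by
  haveI : IsLocallyNoetherian (strictTransformIdeal π C K).subscheme :=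
    LocallyOfFiniteType.isLocallyNoetherian (strictTransformIdeal π C K).subschemeι
  refine isEffectiveCartier_of_forall_mem_nonZeroDivisors fun z' _ => ?_
  set ι := (strictTransformIdeal π C K).subschemeι with hι
  obtain ⟨t, ht0, ht⟩ := hE.exists_stalkIdeal_eq_span (ι z')
  refine ⟨(ι.stalkMap z').hom t, ?_, ?_⟩
  · -- the image of `t` is a non-zero-divisor of `𝒪_{V(St K),z′} = 𝒪_{X′,z} ⧸ (St K)_z` (saturation)
    have hker : stalkIdeal (strictTransformIdeal π C K) (ι z') = RingHom.ker (ι.stalkMap z').hom := by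
      have h1 := stalkIdeal_ker_eq_ker_stalkMap ι z'
      rwa [hι, ker_subschemeι] at h1
    have h0 : ∀ w, w * (ι.stalkMap z').hom t = 0 → w = 0 := by
      intro w hw
      obtain ⟨a, rfl⟩ := ι.stalkMap_surjective z' w
      rw [← map_mul, ← RingHom.mem_ker, ← hker, mul_comm] at hw
      have ha := mem_stalkIdeal_strictTransformIdeal_of_mul_mem π C K (ι z') ht hw
      rw [hker, RingHom.mem_ker] at ha
      exact ha
    exact mem_nonZeroDivisors_iff.mpr ⟨fun w hw => h0 w (by rwa [mul_comm] at hw), h0⟩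
  · rw [stalkIdeal_comap_eq_map_stalkMap, ht, Ideal.map_span, Set.image_singleton]

end Summit.ResolutionOfSingularities.ResolutionOfSingularities.Cruxes.EquisingularLiftNat.Sections

end
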